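import Summits.QuantumFields.GaugeBoot.GaugeStringDuality
import HarnessLib

/-!
# The finite-`N` master loop equation as an approximate symmetrized equation (gauge-boot, ADDENDUM 28 part Q1)

HONEST FRAMING (cell `pub-gaugeboot`, page 1 of every file): the venture produces certified bounds
on lattice expectations at stated coupling, gauge group, dimension and torus size; NOT a mass gap,
NOT a continuum limit, NOT a string tension; NOT Yang–Mills-summit-bearing (barriers
`FixedCouplingUltralocality`, `PerturbativeInvisibility`).  This file is about `SO(N)` lattice gauge theory with free
boundary condition in `ℤ^d` at FINITE `N` and FINITE volume; it says nothing about four-dimensional continuum Yang–Mills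
or a mass gap.

## Content

Preparations for the quantitative form of S. Chatterjee's Theorem 3.1 (Comm. Math. Phys. **366** (2019); sibling
`GaugeStringDualityRate`):
* `card_sameIdx_le`, `card_invIdx_le`, `card_mergeIdx_le` — the operation index sets `𝕊^±(s)`, `𝕋^±(s)`, `𝕄^±(s)` have
  at most `|s|²` elements;
* ★ `finiteN_defect_le` — the finite-`N` master loop equation (the source's Theorem 3.6, tree
  `SOMasterLoop.finiteNMasterLoopEquation_holds`), divided by `N`, IS the symmetrized limiting equation of Theorem 9.9 up
  to the defect `N⁻¹(|s|φ(s) + twisting terms + N⁻¹ merger terms)`, of size `≤ 5|s|²/N` since `|φ| ≤ 1`;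

Everything is `[folklore]` given the source.
-/

noncomputable section

open Finset Filter Topology
open Literature.MathematicalPhysics.QuantumFieldTheory (latticeNorm)
open Literature.MathematicalPhysics.QuantumFieldTheory.Chatterjee2019LargeN
open Literature.MathematicalPhysics.QuantumFieldTheory.Chatterjee2019LargeN.CoeffCatalanBoundProof

namespace Summit.QuantumFields.GaugeBoot

namespace StringDuality

variable {d : ℕ}

/-! ## Cardinalities of the operation index sets: at most `|s|²` -/

/-- `Σᵢ |lᵢ| = |s|` (natural-number form). [cite: Chatterjee2019LargeN, §2.1 (|s| = |l₁| + ⋯ + |lₙ|)] -/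
theorem sum_length_get_nat (s : LoopSeq d) : ∑ i : Fin s.length, (s.get i).length = s.len := by
  exact_mod_cast sum_length_get s

/-- `|𝕊⁺(s)| = |𝕋⁻(s)| ≤ |s|²`. [cite: Chatterjee2019LargeN, §2.2 (the sets 𝕊⁺(s), 𝕋⁻(s))] -/
theorem card_sameIdx_le (s : LoopSeq d) : Fintype.card (SameIdx s) ≤ s.len ^ 2 := by
  rw [Fintype.card_sigma]
  calc ∑ i : Fin s.length, Fintype.card {xy : Fin (s.get i).length × Fin (s.get i).length //
          xy.1 ≠ xy.2 ∧ (s.get i).get xy.2 = (s.get i).get xy.1}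
      ≤ ∑ i : Fin s.length, (s.get i).length * (s.get i).length :=
        Finset.sum_le_sum fun i _ => (Fintype.card_subtype_le _).trans (by rw [Fintype.card_prod, Fintype.card_fin])
    _ ≤ ∑ i : Fin s.length, (s.get i).length * s.len := by
        refine Finset.sum_le_sum fun i _ => Nat.mul_le_mul_left _ ?_
        rw [← sum_length_get_nat]
        exact Finset.single_le_sum (f := fun j : Fin s.length => (s.get j).length) (fun _ _ => Nat.zero_le _)
          (Finset.mem_univ i)
    _ = s.len ^ 2 := by rw [← Finset.sum_mul, sum_length_get_nat, sq]

/-- `|𝕊⁻(s)| = |𝕋⁺(s)| ≤ |s|²`. [cite: Chatterjee2019LargeN, §2.2 (the sets 𝕊⁻(s), 𝕋⁺(s))] -/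
theorem card_invIdx_le (s : LoopSeq d) : Fintype.card (InvIdx s) ≤ s.len ^ 2 := by
  rw [Fintype.card_sigma]
  calc ∑ i : Fin s.length, Fintype.card {xy : Fin (s.get i).length × Fin (s.get i).length //
          (s.get i).get xy.2 = DEdge.inv ((s.get i).get xy.1)}
      ≤ ∑ i : Fin s.length, (s.get i).length * (s.get i).length :=
        Finset.sum_le_sum fun i _ => (Fintype.card_subtype_le _).trans (by rw [Fintype.card_prod, Fintype.card_fin])
    _ ≤ ∑ i : Fin s.length, (s.get i).length * s.len := by
        refine Finset.sum_le_sum fun i _ => Nat.mul_le_mul_left _ ?_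
        rw [← sum_length_get_nat]
        exact Finset.single_le_sum (f := fun j : Fin s.length => (s.get j).length) (fun _ _ => Nat.zero_le _)
          (Finset.mem_univ i)
    _ = s.len ^ 2 := by rw [← Finset.sum_mul, sum_length_get_nat, sq]

/-- `|𝕄^±(s)| ≤ |s|²`. [cite: Chatterjee2019LargeN, §2.2 (the sets 𝕄⁺(s), 𝕄⁻(s))] -/
theorem card_mergeIdx_le (s : LoopSeq d) : Fintype.card (MergeIdx s) ≤ s.len ^ 2 := by
  rw [Fintype.card_sigma]
  calc ∑ i : Fin s.length, Fintype.card (Σ j : Fin s.length,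
          {xy : Fin (s.get i).length × Fin (s.get j).length // i ≠ j ∧ ((s.get j).get xy.2).1 = ((s.get i).get xy.1).1})
      ≤ ∑ i : Fin s.length, ∑ j : Fin s.length, (s.get i).length * (s.get j).length := by
        refine Finset.sum_le_sum fun i _ => ?_
        rw [Fintype.card_sigma]
        exact Finset.sum_le_sum fun j _ => (Fintype.card_subtype_le _).trans
          (by rw [Fintype.card_prod, Fintype.card_fin, Fintype.card_fin])
    _ = s.len ^ 2 := by rw [← Finset.sum_mul_sum, sum_length_get_nat, sq]

/-! ## The finite-`N` master loop equation as an approximate symmetrized equation -/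

/-- A signed sum of at most `|s|²` values of `φ_{Λ,N,β}` is at most `|s|²` in absolute value (`|φ| ≤ 1`).
[cite: Chatterjee2019LargeN, §9 proof of Theorem 9.1 («the fact that |W_l| ≤ N»)] -/
theorem abs_sum_phi_le {ι : Type*} [Fintype ι] (N : ℕ) (β : ℝ) (Λ : Finset (Literature.Probability.LatticeModels.Site d))
    (f : ι → LoopSeq d) {s : LoopSeq d} (hι : Fintype.card ι ≤ s.len ^ 2) :
    |∑ o : ι, phi N β Λ (f o)| ≤ (s.len : ℝ) ^ 2 := by
  calc |∑ o : ι, phi N β Λ (f o)| ≤ ∑ o : ι, |phi N β Λ (f o)| := Finset.abs_sum_le_sum_abs _ _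
    _ ≤ ∑ _o : ι, (1 : ℝ) := Finset.sum_le_sum fun o _ => abs_phi_le_one _ _ _ _
    _ = Fintype.card ι := by rw [Finset.sum_const, Finset.card_univ, nsmul_eq_mul, mul_one]
    _ ≤ (s.len : ℝ) ^ 2 := by exact_mod_cast hι

/-- **The finite-`N` symmetrized master loop equation (Theorem 3.6) as the limiting equation with an `O(1/N)` defect**:
for `N ≥ 2`, a non-empty `Λ`, any real `β` and a genuine non-null `s` with its unit vertex neighbourhood in `Λ`,
`| |s| φ(s) − (Σ_{𝕊⁻} φ − Σ_{𝕊⁺} φ + β Σ_{𝔻⁻} φ − β Σ_{𝔻⁺} φ) | ≤ 5|s|²/N` for `φ = φ_{Λ,N,β}` (the defect is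
`N⁻¹(|s|φ(s) + twisting terms + N⁻¹ merger terms)`). [cite: Chatterjee2019LargeN, Theorem 3.6; Theorem 9.9 (proof: divide by N)] -/
theorem finiteN_defect_le (hd : 2 ≤ d) {Λ : Finset (Literature.Probability.LatticeModels.Site d)} (hΛ : Λ.Nonempty)
    {N : ℕ} (hN : 2 ≤ N) (β : ℝ) {s : LoopSeq d} (hs : IsLoopSeq s) (hne : s ≠ [])
    (hV : ∀ l ∈ s, ∀ a ∈ l, ∀ v : Literature.Probability.LatticeModels.Site d,
      latticeNorm (v - DEdge.src a) ≤ 1 ∨ latticeNorm (v - DEdge.tgt a) ≤ 1 → v ∈ Λ) :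
    |(s.len : ℝ) * phi N β Λ s -
        ((∑ o : InvIdx s, phi N β Λ (s.negSplitAt o)) - (∑ o : SameIdx s, phi N β Λ (s.posSplitAt o))
          + β * (∑ o : DeformIdx s, phi N β Λ (s.negDeformAt o))
          - β * (∑ o : DeformIdx s, phi N β Λ (s.posDeformAt o)))| ≤ 5 * (s.len : ℝ) ^ 2 / N := by
  have h := SOMasterLoop.finiteNMasterLoopEquation_holds d hd Λ hΛ N hN β s hs hne hV
  have hN0 : (0 : ℝ) < N := by exact_mod_cast (by omega : 0 < N)
  have hN1 : (1 : ℝ) ≤ N := by exact_mod_cast (by omega : 1 ≤ N)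
  set L : ℝ := (s.len : ℝ) with hL
  set Tw : ℝ := (∑ o : SameIdx s, phi N β Λ (s.negTwistAt o)) - ∑ o : InvIdx s, phi N β Λ (s.posTwistAt o) with hTw
  set Me : ℝ := (∑ o : MergeIdx s, phi N β Λ (s.negMergeAt o)) - ∑ o : MergeIdx s, phi N β Λ (s.posMergeAt o) with hMe
  set Sp : ℝ := (∑ o : InvIdx s, phi N β Λ (s.negSplitAt o)) - ∑ o : SameIdx s, phi N β Λ (s.posSplitAt o) with hSp
  set De : ℝ := (∑ o : DeformIdx s, phi N β Λ (s.negDeformAt o)) - ∑ o : DeformIdx s, phi N β Λ (s.posDeformAt o)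
    with hDe
  have h' : ((N : ℝ) - 1) * L * phi N β Λ s = Tw + N * Sp + (1 / (N : ℝ)) * Me + N * β * De := by
    rw [h, hTw, hSp, hMe, hDe]
    ring
  have key : L * phi N β Λ s -
      ((∑ o : InvIdx s, phi N β Λ (s.negSplitAt o)) - (∑ o : SameIdx s, phi N β Λ (s.posSplitAt o))
        + β * (∑ o : DeformIdx s, phi N β Λ (s.negDeformAt o))
        - β * (∑ o : DeformIdx s, phi N β Λ (s.posDeformAt o))) =
      (L * phi N β Λ s + Tw + (1 / (N : ℝ)) * Me) / N := by
    have e1 : L * phi N β Λ s -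
        ((∑ o : InvIdx s, phi N β Λ (s.negSplitAt o)) - (∑ o : SameIdx s, phi N β Λ (s.posSplitAt o))
          + β * (∑ o : DeformIdx s, phi N β Λ (s.negDeformAt o))
          - β * (∑ o : DeformIdx s, phi N β Λ (s.posDeformAt o))) = L * phi N β Λ s - Sp - β * De := by
      rw [hSp, hDe]; ring
    rw [e1, eq_div_iff hN0.ne']
    linear_combination h'
  rw [key, abs_div, abs_of_pos hN0]
  -- the bracket is at most `5|s|²`
  have hL1 : (1 : ℝ) ≤ L := by
    have h1 := two_mul_size_le_len hs
    have h2 : 1 ≤ s.size := List.length_pos_of_ne_nil hne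
    have h3 : 1 ≤ s.len := by omega
    rw [hL]; exact_mod_cast h3
  have hφ : |L * phi N β Λ s| ≤ L ^ 2 := by
    rw [abs_mul, abs_of_nonneg (by positivity : (0 : ℝ) ≤ L), sq]
    exact mul_le_mul_of_nonneg_left ((abs_phi_le_one _ _ _ _).trans hL1) (by positivity)
  have hTw' : |Tw| ≤ L ^ 2 + L ^ 2 :=
    (abs_sub _ _).trans (add_le_add (abs_sum_phi_le N β Λ _ (card_sameIdx_le s))
      (abs_sum_phi_le N β Λ _ (card_invIdx_le s)))
  have hMe' : |Me| ≤ L ^ 2 + L ^ 2 :=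
    (abs_sub _ _).trans (add_le_add (abs_sum_phi_le N β Λ _ (card_mergeIdx_le s))
      (abs_sum_phi_le N β Λ _ (card_mergeIdx_le s)))
  have hMe'' : |(1 / (N : ℝ)) * Me| ≤ L ^ 2 + L ^ 2 := by
    rw [abs_mul, abs_of_pos (by positivity : (0 : ℝ) < 1 / N)]
    calc 1 / (N : ℝ) * |Me| ≤ 1 * |Me| := by
          refine mul_le_mul_of_nonneg_right ?_ (abs_nonneg _)
          rw [div_le_iff₀ hN0]; linarith
      _ ≤ L ^ 2 + L ^ 2 := by rw [one_mul]; exact hMe'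
  have hbr : |L * phi N β Λ s + Tw + (1 / (N : ℝ)) * Me| ≤ 5 * L ^ 2 := by
    calc |L * phi N β Λ s + Tw + (1 / (N : ℝ)) * Me| ≤ |L * phi N β Λ s| + |Tw| + |(1 / (N : ℝ)) * Me| := abs_add_three _ _ _
      _ ≤ L ^ 2 + (L ^ 2 + L ^ 2) + (L ^ 2 + L ^ 2) := add_le_add (add_le_add hφ hTw') hMe''
      _ = 5 * L ^ 2 := by ring
  exact div_le_div_of_nonneg_right hbr hN0.le

end StringDuality

end Summit.QuantumFields.GaugeBoot

end
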